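import Summits.RiemannHypothesis.RiemannHypothesis.Theorems.UniversalFactorLaplaceLoopholePairCriterion
import Summits.RiemannHypothesis.RiemannHypothesis.Theorems.UniversalFactorLaguerreCriterion

/-!
# RiemannHypothesis / UniversalFactor — the close-pair criterion in one-sided-average form
(the shape the ball-arithmetic certificates of the Laplace-loophole compute programme verify)

Refuter file (compute-scan seat `lscan-RiemannHypothesis-2575`), `--supports stmt-RiemannHypothesis-2575`
(crux `LaplaceLoophole`); also serves `MediumKernelNoGo` (stmt-2577), `LehmerPointNoGo` (stmt-2582) and the
certified floor of `NarrowKernelNoGo` (stmt-2576).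

With `F = F_a = deBruijnHDiv (1 + u²/a²)` and the one-sided Laplace averages
`P_a(x) = ∫₀^∞ H_0(x − y) e^{−ay} dy`, `Q_a(x) = ∫₀^∞ H_0(x + y) e^{−ay} dy` one has, for real `x`
(resp. `x ≥ 0`), `F_a(x) = (a/2)(P_a(x) + Q_a(x))` (`UniversalFactor.deBruijnHDiv_laplace_eq_half_mul_add`)
and `F_a'(x) + aF_a(x) = a² Q_a(x)`, `F_a'(x) − aF_a(x) = −a² P_a(x)`
(`UniversalFactor.deriv_add_mul_eq_forward` / `deriv_sub_mul_eq_backward`).  Hence the two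
one-signedness hypotheses of the tree's close-pair criterion
`UniversalFactor.not_hasOnlyRealZeros_of_pair_signs` (`F ≠ 0` on `[u₁ + η, v₃]`, `F' + aF ≠ 0` on
`[u₁, v₁ + η]`) are statements about the real numbers `P_a(x) + Q_a(x)` and `Q_a(x)` — finite sums of
integrals of `H_0` against POSITIVE kernels, which interval arithmetic bounds monotonically, uniformly for
`a` in an interval (`e^{−a₂y} ≤ e^{−ay} ≤ e^{−a₁y}`).  This file records exactly these forms:

* `UniversalFactor.not_hasOnlyRealZeros_of_pair_signs_PQ` — buffer `η` to the right of the outer zero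
  `h₁ ∈ [u₁, v₁]` (lost pair `(h₂, h₃)`), hypotheses `P + Q ≠ 0` on `[u₁ + η, v₃]`, `Q ≠ 0` on `[u₁, v₁ + η]`;
* `UniversalFactor.not_hasOnlyRealZeros_of_pair_signs'` — the mirror image of the tree's sign-data
  criterion (buffer to the LEFT of the outer zero `h₃`, from `UniversalFactor.not_hasOnlyRealZeros_of_pair'`);
* `UniversalFactor.not_hasOnlyRealZeros_of_pair_signs'_PQ` — its one-sided-average form
  (`P + Q ≠ 0` on `[u₁, v₃ − η]`, `P ≠ 0` on `[u₃ − η, v₃]`).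

The certificates themselves (kit jobs tagged `cert`, python-flint/Arb, attached as evidence to
stmt-RiemannHypothesis-2575) list, per `a`-window `[a₁, a₂]` and close pair, dyadic `u_i, v_i, η` and the
certified signs; each instance discharges the hypotheses below for every `a ∈ [a₁, a₂]`.
-/

noncomputable section

set_option linter.dupNamespace false

namespace Summit.RiemannHypothesis.RiemannHypothesis.Theorems

open MeasureTheory Set Filter Complex
open scoped Topology
open Literature.NumberTheory.LFunctions
open Summit.RiemannHypothesis.RiemannHypothesis.Theses

/-- **Close-pair criterion, one-sided-average form** (buffer right of `h₁`). `a > 0`, `0 ≤ u₁`, `0 ≤ η`;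
brackets `u₁ ≤ v₁`, `u₂ ≤ v₂`, `u₃ ≤ v₃`, `v₁ + η ≤ u₂`, `v₂ ≤ u₃` with sign changes of `Re H_0`; the sum
of the one-sided Laplace averages `P_a + Q_a` does not vanish on `[u₁ + η, v₃]` and the forward average
`Q_a` does not vanish on `[u₁, v₁ + η]`.  Then `F_a` has a non-real zero. [folklore] -/
theorem UniversalFactor.not_hasOnlyRealZeros_of_pair_signs_PQ {a : ℝ} (ha : 0 < a)
    {η u₁ v₁ u₂ v₂ u₃ v₃ : ℝ} (hu₁ : 0 ≤ u₁)
    (hη : 0 ≤ η) (huv₁ : u₁ ≤ v₁) (huv₂ : u₂ ≤ v₂) (huv₃ : u₃ ≤ v₃) (h12 : v₁ + η ≤ u₂) (h23 : v₂ ≤ u₃)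
    (hs₁ : (deBruijnH 0 u₁).re * (deBruijnH 0 v₁).re < 0)
    (hs₂ : (deBruijnH 0 u₂).re * (deBruijnH 0 v₂).re < 0)
    (hs₃ : (deBruijnH 0 u₃).re * (deBruijnH 0 v₃).re < 0)
    (hF : ∀ x ∈ Icc (u₁ + η) v₃,
      (∫ y in Ioi (0:ℝ), deBruijnH 0 ((x : ℂ) - y) * (Real.exp (-(a * y)) : ℂ)).re +
        (∫ y in Ioi (0:ℝ), deBruijnH 0 ((x : ℂ) + y) * (Real.exp (-(a * y)) : ℂ)).re ≠ 0)
    (hQ : ∀ x ∈ Icc u₁ (v₁ + η),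
      (∫ y in Ioi (0:ℝ), deBruijnH 0 ((x : ℂ) + y) * (Real.exp (-(a * y)) : ℂ)).re ≠ 0) :
    ¬ HasOnlyRealZeros (deBruijnHDiv fun u : ℝ => 1 + u ^ 2 / a ^ 2) := by
  refine UniversalFactor.not_hasOnlyRealZeros_of_pair_signs ha hη huv₁ huv₂ huv₃ h12 h23 hs₁ hs₂ hs₃
    ?_ ?_
  · intro x hx hFx
    have hmean := UniversalFactor.deBruijnHDiv_laplace_eq_half_mul_add ha x
    rw [hFx] at hmean
    have ha2 : (a / 2 : ℂ) ≠ 0 := by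
      have : (a : ℂ) ≠ 0 := by exact_mod_cast ha.ne'
      exact div_ne_zero this two_ne_zero
    have hsum := (mul_eq_zero.1 hmean.symm).resolve_left ha2
    have hre := congrArg Complex.re hsum
    simp only [Complex.add_re, Complex.zero_re] at hre
    exact hF x hx hre
  · intro x hx hGx
    have hx0 : 0 ≤ x := hu₁.trans hx.1
    have hfwd := UniversalFactor.deriv_add_mul_eq_forward ha hx0
    rw [hGx] at hfwd
    have ha2 : (a : ℂ) ^ 2 ≠ 0 := pow_ne_zero 2 (by exact_mod_cast ha.ne')
    have hQ0 := (mul_eq_zero.1 hfwd.symm).resolve_left ha2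
    have hre := congrArg Complex.re hQ0
    simp only [Complex.zero_re] at hre
    exact hQ x hx hre

/-- **The close-pair criterion from sign data, mirrored** (buffer to the left of the outer zero
`h₃ ∈ [u₃, v₃]`; lost pair `(h₁, h₂)`): `a > 0`, `0 ≤ η`; brackets `u₁ ≤ v₁`, `u₂ ≤ v₂`, `u₃ ≤ v₃` with
`v₁ ≤ u₂`, `v₂ + η ≤ u₃` and sign changes of `Re H_0` on each; `F_a ≠ 0` on `[u₁, v₃ − η]`;
`F_a' − aF_a ≠ 0` on `[u₃ − η, v₃]`.  Then `F_a` has a non-real zero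
(from `UniversalFactor.not_hasOnlyRealZeros_of_pair'`). [folklore] -/
theorem UniversalFactor.not_hasOnlyRealZeros_of_pair_signs' {a : ℝ} (ha : 0 < a)
    {η u₁ v₁ u₂ v₂ u₃ v₃ : ℝ}
    (hη : 0 ≤ η) (huv₁ : u₁ ≤ v₁) (huv₂ : u₂ ≤ v₂) (huv₃ : u₃ ≤ v₃) (h12 : v₁ ≤ u₂) (h23 : v₂ + η ≤ u₃)
    (hs₁ : (deBruijnH 0 u₁).re * (deBruijnH 0 v₁).re < 0)
    (hs₂ : (deBruijnH 0 u₂).re * (deBruijnH 0 v₂).re < 0)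
    (hs₃ : (deBruijnH 0 u₃).re * (deBruijnH 0 v₃).re < 0)
    (hF : ∀ x ∈ Icc u₁ (v₃ - η), deBruijnHDiv (fun u : ℝ => 1 + u ^ 2 / a ^ 2) x ≠ 0)
    (hG : ∀ x ∈ Icc (u₃ - η) v₃, deriv (deBruijnHDiv fun u : ℝ => 1 + u ^ 2 / a ^ 2) x -
      (a : ℂ) * deBruijnHDiv (fun u : ℝ => 1 + u ^ 2 / a ^ 2) x ≠ 0) :
    ¬ HasOnlyRealZeros (deBruijnHDiv fun u : ℝ => 1 + u ^ 2 / a ^ 2) := by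
  have hcont : Continuous fun x : ℝ => (deBruijnH 0 x).re :=
    Complex.continuous_re.comp
      ((differentiable_deBruijnH_holds 0).continuous.comp Complex.continuous_ofReal)
  have him : ∀ x : ℝ, (deBruijnH 0 x).im = 0 := fun x => by
    rw [← deBruijnHDiv_one']; exact deBruijnHDiv_ofReal_im _ x
  have hzero : ∀ {u v : ℝ}, u ≤ v → (deBruijnH 0 u).re * (deBruijnH 0 v).re < 0 →
      ∃ x ∈ Icc u v, deBruijnH 0 x = 0 := by
    intro u v huv hs
    obtain ⟨x, hxI, hx0⟩ : ∃ x ∈ Icc u v, (deBruijnH 0 x).re = 0 := by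
      rcases mul_neg_iff.1 hs with ⟨hu, hv⟩ | ⟨hu, hv⟩
      · exact intermediate_value_Icc' huv hcont.continuousOn ⟨hv.le, hu.le⟩
      · exact intermediate_value_Icc huv hcont.continuousOn ⟨hu.le, hv.le⟩
    exact ⟨x, hxI, Complex.ext (by simpa using hx0) (by simpa using him x)⟩
  obtain ⟨h₁, hh₁, hz₁⟩ := hzero huv₁ hs₁
  obtain ⟨h₂, hh₂, hz₂⟩ := hzero huv₂ hs₂
  obtain ⟨h₃, hh₃, hz₃⟩ := hzero huv₃ hs₃
  have hre0 : ∀ x : ℝ, deBruijnH 0 x = 0 → (deBruijnH 0 x).re = 0 := fun x hx => by rw [hx]; simp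
  have hv₁ : (deBruijnH 0 v₁).re ≠ 0 := fun h => by rw [h, mul_zero] at hs₁; exact lt_irrefl _ hs₁
  have hv₂ : (deBruijnH 0 v₂).re ≠ 0 := fun h => by rw [h, mul_zero] at hs₂; exact lt_irrefl _ hs₂
  have h1v : h₁ < v₁ := lt_of_le_of_ne hh₁.2 fun h => hv₁ (h ▸ hre0 h₁ hz₁)
  have h2v : h₂ < v₂ := lt_of_le_of_ne hh₂.2 fun h => hv₂ (h ▸ hre0 h₂ hz₂)
  have hlt12 : h₁ < h₂ := by linarith [hh₂.1]
  have hlt23 : h₂ < h₃ := by linarith [hh₃.1]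
  exact UniversalFactor.not_hasOnlyRealZeros_of_pair' (h₁ := h₁) (h₂ := h₂) (h₃ := h₃) (η := η) ha
    hlt12 hlt23 hη (by linarith [hh₂.2, hh₃.1]) hz₁ hz₂ hz₃
    (fun x hx => hF x ⟨hh₁.1.trans hx.1, by linarith [hx.2, hh₃.2]⟩)
    (fun x hx => hG x ⟨by linarith [hx.1, hh₃.1], hx.2.trans hh₃.2⟩)

/-- **Mirrored close-pair criterion, one-sided-average form** (buffer left of `h₃`). `a > 0`, `0 ≤ u₁`,
`0 ≤ η`, `u₃ − η ≥ 0`; brackets as in `not_hasOnlyRealZeros_of_pair_signs'`; `P_a + Q_a ≠ 0` on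
`[u₁, v₃ − η]` and the backward average `P_a ≠ 0` on `[u₃ − η, v₃]`.  Then `F_a` has a non-real zero.
[folklore] -/
theorem UniversalFactor.not_hasOnlyRealZeros_of_pair_signs'_PQ {a : ℝ} (ha : 0 < a)
    {η u₁ v₁ u₂ v₂ u₃ v₃ : ℝ} (hu₃ : η ≤ u₃)
    (hη : 0 ≤ η) (huv₁ : u₁ ≤ v₁) (huv₂ : u₂ ≤ v₂) (huv₃ : u₃ ≤ v₃) (h12 : v₁ ≤ u₂) (h23 : v₂ + η ≤ u₃)
    (hs₁ : (deBruijnH 0 u₁).re * (deBruijnH 0 v₁).re < 0)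
    (hs₂ : (deBruijnH 0 u₂).re * (deBruijnH 0 v₂).re < 0)
    (hs₃ : (deBruijnH 0 u₃).re * (deBruijnH 0 v₃).re < 0)
    (hF : ∀ x ∈ Icc u₁ (v₃ - η),
      (∫ y in Ioi (0:ℝ), deBruijnH 0 ((x : ℂ) - y) * (Real.exp (-(a * y)) : ℂ)).re +
        (∫ y in Ioi (0:ℝ), deBruijnH 0 ((x : ℂ) + y) * (Real.exp (-(a * y)) : ℂ)).re ≠ 0)
    (hP : ∀ x ∈ Icc (u₃ - η) v₃,
      (∫ y in Ioi (0:ℝ), deBruijnH 0 ((x : ℂ) - y) * (Real.exp (-(a * y)) : ℂ)).re ≠ 0) :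
    ¬ HasOnlyRealZeros (deBruijnHDiv fun u : ℝ => 1 + u ^ 2 / a ^ 2) := by
  refine UniversalFactor.not_hasOnlyRealZeros_of_pair_signs' ha hη huv₁ huv₂ huv₃ h12 h23 hs₁ hs₂ hs₃
    ?_ ?_
  · intro x hx hFx
    have hmean := UniversalFactor.deBruijnHDiv_laplace_eq_half_mul_add ha x
    rw [hFx] at hmean
    have ha2 : (a / 2 : ℂ) ≠ 0 := by
      have : (a : ℂ) ≠ 0 := by exact_mod_cast ha.ne'
      exact div_ne_zero this two_ne_zero
    have hsum := (mul_eq_zero.1 hmean.symm).resolve_left ha2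
    have hre := congrArg Complex.re hsum
    simp only [Complex.add_re, Complex.zero_re] at hre
    exact hF x hx hre
  · intro x hx hGx
    have hx0 : 0 ≤ x := by linarith [hx.1]
    have hbwd := UniversalFactor.deriv_sub_mul_eq_backward ha hx0
    rw [hGx] at hbwd
    have ha2 : -(a : ℂ) ^ 2 ≠ 0 := neg_ne_zero.2 (pow_ne_zero 2 (by exact_mod_cast ha.ne'))
    have hP0 := (mul_eq_zero.1 hbwd.symm).resolve_left ha2
    have hre := congrArg Complex.re hP0
    simp only [Complex.zero_re] at hre
    exact hP x hx hre

end Summit.RiemannHypothesis.RiemannHypothesis.Theorems
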